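import Summits.QuantumFields.YangMills.Theorems.BalabanUVNodesK0Stub1SectFWSlotAtRecordFlatChart
import Summits.QuantumFields.YangMills.Theorems.BalabanUVNodesK0Stub1FlatChartRemainderP
import HarnessLib

/-!
# K0⁷ STUB 1 (`stub_prop8StepCoP13`), sub-target S4b — **THE ♭ W-SLOT WITH THE REMAINDER SOCKET CLOSED**: p623337's ♭ junction
# `exists_sectF_W_atRecord_flatChart` with its displayed remainder socket (`ε`, `C_D`, `Dfun`, (55), analyticity) DISCHARGED by FILE 12′
# `K0Stub1FlatChartRemainderP.flatChartRemainderSocket_T4` at `Dfun♭ := chartLogFlat − D(chartLogFlat)(0)`, `ε := R⋆♭∕4`, `C_D := 64L∕R⋆♭` (k-UNIFORM, functions of `L`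
# only) — what stays displayed on the ♭ road: `θ₀` (k0-s1-w2's θ₀ socket: `hentry` + `hcol` of the ♭ kernel) and the arithmetic letter `ℓ`

Cell `pub-ymgap`, width seat `pub-ymgap-k0-s1-w4` g0′ (FILE 13).  `--kind proof --supports stmt-QuantumFields-20541 --as helper`; count-neutral.

WHAT IS PROVED (sorry-free; no definition; axioms standard).
* ★★★ `exists_sectF_W_atRecord_flatChart_closedRemainder` — for every `F : T4Family`, `N ≥ 1`: `∃ Mh₀ R₀, O₁ B♭ h₀ ≥ 0, ε > 0, C_D ≥ 0` (all before the family: k-UNIFORM) such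
  that at every admissible nested family of the record's four-tori in the standing range (`R ≥ R₀ ≥ 2L`), for the (152) weights, EVERY ℂ-linear `H` with the ♭ kernel, the fibre
  letters, the pairings and EVERY `M_V` with p598821's kernel: transposes `Qt, Ht, Dt` of `Qlin♭`, `H`, `D(Dfun♭)(A′)` exist and, for every `θ₀ ≥ 0`, `ℓ` with
  `1 + B♭C_Dε ≤ ℓ`, `ℓε ≤ 1∕16` and the letter `h73t(θ₀)`, the (157) `HasFDerivAt` ∕ `DifferentiableOn` ∕ (158) row of p623337 hold with `Dfun := Dfun♭` WRITTEN OUT.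
HONEST SCOPE.  `exact` assembly of p623337 with FILE 12′ §4; nothing of Bałaban's analysis asserted beyond the cited engines; `θ₀` and `ℓ` displayed; `stub_prop8StepCoP13` ∕ K0⁷
NOT closed; N07 NOT discharged; no summit statement is proved by this seat; counts unmoved (28∕28 · 5∕27); R4 closes the conditional finite-𝕋⁴ rung `BalabanLadder.UV` only,
never the summit; the YM mass gap (Clay) is NOT proved by any of this; nothing continuum ∕ ℝ⁴ ∕ OS.  No `sorry`, no `def`, no `instance`, no `notation`.
References: [Balaban1985Variational] (44)–(48) p.285, (55) p.286, Prop. 4 (97)–(98) pp.292–293, (157)–(158) p.302; [Balaban1985Averaging] Props. 3–4 pp.36–38;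
[Balaban1984PropagatorsII] Cor. 2.8 p.249; [Balaban1987RG1] (0.1) p.251.
-/

set_option autoImplicit false

noncomputable section

open scoped BigOperators Matrix.Norms.L2Operator Topology ContDiff

namespace Summit.QuantumFields.YangMills.Theorems.K0Stub1SectFWSlotAtRecordFlatChartClosed

open Literature.MathematicalPhysics.QuantumFieldTheory.Balaban1983to89
open Literature.MathematicalPhysics.QuantumFieldTheory.Balaban1983to89.T4Continuum (T4Family)
open B6SectADomainsV1 (Domains)
open B6SectAOperatorsV1 (BondIdx aE)
open B6SectAVectorModelV1 (EE)
open B9Eq39Adjoint (bondPair)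
open B11Eq26ActionExpansion (V0)
open B4Sect5Torus (TSite)
open Summit.QuantumFields.YangMills.Theorems.FlatCubeOpsText (Adm22)
open Summit.QuantumFields.YangMills.Theorems.K0FlatCubeOpsTextP (IsLevWeight flatH)
open Summit.QuantumFields.YangMills.Theorems.Prop8ChartDoubleBar (chartLogFlat)
open Summit.QuantumFields.YangMills.Theorems.K0Stub1SectFWSlotAtRecordFlatChart (exists_sectF_W_atRecord_flatChart)
open Summit.QuantumFields.YangMills.Theorems.K0Stub1FlatChartRemainderP (flatChartRemainderSocket_T4)

/-- ★★★ **THE ♭ W-SLOT OF (157) AT THE RECORD WITH THE REMAINDER SOCKET CLOSED** (`Dfun♭ := chartLogFlat − D(chartLogFlat)(0)` written out; `ε = R⋆♭∕4`, `C_D = 64L∕R⋆♭`,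
`R⋆♭ = (60800·(6L)²·L)⁻¹` chosen in the proof, quantified BEFORE the family): p623337 `exists_sectF_W_atRecord_flatChart` ∘ FILE 12′ `flatChartRemainderSocket_T4`.
Displayed: `θ₀` (the `h73t` letter) and `ℓ`. [cite: Balaban1985Variational, (44)-(48) p.285, (55) p.286, Prop. 4 (97)-(98) pp.292-293, (157)-(158) p.302; Balaban1985Averaging, Prop. 4 p.38; Balaban1987RG1, (0.1) p.251] -/
theorem exists_sectF_W_atRecord_flatChart_closedRemainder (N : ℕ) [NeZero N] (F : T4Family) :
    ∃ (Mh₀ R₀ : ℕ) (O₁ Bf h₀ ε CD : ℝ), 0 ≤ O₁ ∧ 0 ≤ Bf ∧ 0 ≤ h₀ ∧ 0 < ε ∧ 0 ≤ CD ∧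
    ∀ (n K : ℕ) (_ : 1 ≤ K - n) (_ : K - n + 1 ≤ F.m + K) {Mh R a' : ℕ} (_ : Mh = F.L ^ a') (_ : Mh₀ ≤ Mh) (_ : R₀ ≤ R)
      (_ : a' + 3 ≤ F.m + n) (D : Domains (F.P K)) (hDk : D.k = K - n) (_ : Adm22 D R (F.L * Mh))
      [Fact ((0 : ℝ) < ((F.P K).L : ℝ))] [Fact ((0 : ℝ) < (((F.P K).L : ℝ))⁻¹ ^ (K - n))]
    {w : ℕ → PBond (F.P K) 0 → ℝ} (hw : IsLevWeight (F.P K) (K - n) D w)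
    -- the ♭ right inverse: ANY ℂ-linear map with the kernel `(L^{j(t)}η)⁻¹·(flatH e_t)(b)`
    (H : (BondIdx D → Matrix (Fin N) (Fin N) ℂ) →ₗ[ℂ] (PBond (F.P K) 0 → Matrix (Fin N) (Fin N) ℂ))
    (hH : ∀ (X : BondIdx D → Matrix (Fin N) (Fin N) ℂ) (b : PBond (F.P K) 0), H X b =
      ∑ t, (((((F.P K).L : ℝ) ^ (t.1.1 : ℕ) * ((((F.P K).L : ℝ))⁻¹) ^ (K - n))⁻¹ * flatH (F.P K) (K - n) D (Pi.single t 1) b : ℝ) : ℂ) • X t)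
    -- the fibre letters and the pairings
    (τ : Matrix (Fin N) (Fin N) ℂ →L[ℂ] ℂ) (ρ : (Matrix (Fin N) (Fin N) ℂ →L[ℂ] ℂ) →L[ℂ] Matrix (Fin N) (Fin N) ℂ)
    (hρ : ∀ (ℓ' : Matrix (Fin N) (Fin N) ℂ →L[ℂ] ℂ) (X : Matrix (Fin N) (Fin N) ℂ), τ (ρ ℓ' * X) = ℓ' X)
    (hτ : ∀ a b : Matrix (Fin N) (Fin N) ℂ, τ (a * b) = τ (b * a)) (hτs : ∀ a : Matrix (Fin N) (Fin N) ℂ, τ (star a) = starRingEnd ℂ (τ a))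
    (hτ1 : ∀ X : Matrix (Fin N) (Fin N) ℂ, ‖τ X‖ ≤ ‖X‖) {Mρ : ℝ} (hMρ : 0 ≤ Mρ) (hρn : ∀ ℓ' : Matrix (Fin N) (Fin N) ℂ →L[ℂ] ℂ, ‖ρ ℓ'‖ ≤ Mρ * ‖ℓ'‖)
    (BE : (PBond (F.P K) 0 → Matrix (Fin N) (Fin N) ℂ) →L[ℂ] (PBond (F.P K) 0 → Matrix (Fin N) (Fin N) ℂ) →L[ℂ] ℂ)
    (hBE : ∀ Y δ : PBond (F.P K) 0 → Matrix (Fin N) (Fin N) ℂ, BE Y δ =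
      bondPair ((((F.P K).L : ℝ))⁻¹ ^ (K - n)) (F.P K).d (τ : Matrix (Fin N) (Fin N) ℂ →ₗ[ℂ] ℂ) (fun μ x => Y ⟨x, μ⟩) (fun μ x => δ ⟨x, μ⟩))
    (B : (BondIdx D → Matrix (Fin N) (Fin N) ℂ) →L[ℂ] (BondIdx D → Matrix (Fin N) (Fin N) ℂ) →L[ℂ] ℂ)
    (hB : ∀ X X' : BondIdx D → Matrix (Fin N) (Fin N) ℂ, B X X' = ∑ t, τ (X t * X' t)) (hBsymm : ∀ a b, B a b = B b a)
    -- the multiplier of record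
    (hc : ((F.P K).L : ℝ) ^ (K - n) ≠ 0) {wa : BondIdx D → ℝ} (hwa : ∀ i, 0 < wa i)
    (MV : (BondIdx D → Matrix (Fin N) (Fin N) ℂ) →L[ℂ] (BondIdx D → Matrix (Fin N) (Fin N) ℂ))
    (hMV : ∀ (X : BondIdx D → Matrix (Fin N) (Fin N) ℂ) (t : BondIdx D),
      MV X t = ∑ s, ((WithLp.ofLp ((EE D hc hwa - aE D wa) (WithLp.toLp 2 (Pi.single s 1))) t : ℝ) : ℂ) • X s)
    (hMsym : ∀ a b, B (MV a) b = B a (MV b)),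
    ∃ (Qt : (BondIdx D → Matrix (Fin N) (Fin N) ℂ) →L[ℂ] (PBond (F.P K) 0 → Matrix (Fin N) (Fin N) ℂ)) (Ht : (PBond (F.P K) 0 → Matrix (Fin N) (Fin N) ℂ) →L[ℂ] (BondIdx D → Matrix (Fin N) (Fin N) ℂ))
      (Dt : (PBond (F.P K) 0 → Matrix (Fin N) (Fin N) ℂ) → ((BondIdx D → Matrix (Fin N) (Fin N) ℂ) →L[ℂ] (PBond (F.P K) 0 → Matrix (Fin N) (Fin N) ℂ))),
      (∀ X δ, BE (Qt X) δ = B X (fderiv ℂ (chartLogFlat (((((F.P K).L : ℝ))⁻¹) ^ (K - n)) D :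
        (PBond (F.P K) 0 → Matrix (Fin N) (Fin N) ℂ) → BondIdx D → Matrix (Fin N) (Fin N) ℂ) 0 δ)) ∧
      (∀ Z X, BE Z (H X) = B (Ht Z) X) ∧
      (∀ (A' : PBond (F.P K) 0 → Matrix (Fin N) (Fin N) ℂ) X δ, BE (Dt A' X) δ = B X (fderiv ℂ (fun A : PBond (F.P K) 0 → Matrix (Fin N) (Fin N) ℂ => chartLogFlat (((((F.P K).L : ℝ))⁻¹) ^ (K - n)) D A -
              (fderiv ℂ (chartLogFlat (((((F.P K).L : ℝ))⁻¹) ^ (K - n)) D : (PBond (F.P K) 0 → Matrix (Fin N) (Fin N) ℂ) → BondIdx D → Matrix (Fin N) (Fin N) ℂ) 0) A) A' δ)) ∧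
      ∀ (θ₀ ℓ : ℝ), 0 ≤ θ₀ → 1 + Bf * CD * ε ≤ ℓ → ℓ * ε ≤ 1 / 16 →
        (∀ (A' : PBond (F.P K) 0 → Matrix (Fin N) (Fin N) ℂ) (r : ℝ), (∀ b, w 1 b * ‖A' b‖ ≤ r) →
          (∀ (b : PBond (F.P K) 0) (ν : Fin (F.P K).d), w 2 b * ((F.P K).L : ℝ) ^ (K - n) * ‖A' ⟨b.src.shift ν, b.dir⟩ - A' b‖ ≤ r) → r < ε →
          ∀ (X : BondIdx D → Matrix (Fin N) (Fin N) ℂ) (s : ℝ), (∀ i, (1 : ℝ) * ‖X i‖ ≤ s) → ∀ b, w 3 b * ‖Dt A' X b‖ ≤ θ₀ * r * s) →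
        ∃ (e : Site (F.P K) 0 ≃ TSite (F.P K).d (fun _ => (F.P K).sitesPerDir 0)) (W : (PBond (F.P K) 0 → Matrix (Fin N) (Fin N) ℂ) → (PBond (F.P K) 0 → Matrix (Fin N) (Fin N) ℂ)),
          (∀ (x : Site (F.P K) 0) (μ : Fin (F.P K).d), e (x.shift μ) = B9SectCLatticeCarrier.shift μ (e x)) ∧
          (∀ A' : PBond (F.P K) 0 → Matrix (Fin N) (Fin N) ℂ, (∀ b, w 1 b * ‖A' b‖ < ε) →
            (∀ (b : PBond (F.P K) 0) (ν : Fin (F.P K).d), w 2 b * ((F.P K).L : ℝ) ^ (K - n) * ‖A' ⟨b.src.shift ν, b.dir⟩ - A' b‖ < ε) →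
            HasFDerivAt (fun A : PBond (F.P K) 0 → Matrix (Fin N) (Fin N) ℂ => 2⁻¹ * B ((fun A : PBond (F.P K) 0 → Matrix (Fin N) (Fin N) ℂ => chartLogFlat (((((F.P K).L : ℝ))⁻¹) ^ (K - n)) D A -
              (fderiv ℂ (chartLogFlat (((((F.P K).L : ℝ))⁻¹) ^ (K - n)) D : (PBond (F.P K) 0 → Matrix (Fin N) (Fin N) ℂ) → BondIdx D → Matrix (Fin N) (Fin N) ℂ) 0) A) A) (((((((((F.P K).L : ℝ))⁻¹) ^ (K - n) : ℝ) : ℂ) ^ (F.P K).d) • MV) ((fun A : PBond (F.P K) 0 → Matrix (Fin N) (Fin N) ℂ => chartLogFlat (((((F.P K).L : ℝ))⁻¹) ^ (K - n)) D A -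
              (fderiv ℂ (chartLogFlat (((((F.P K).L : ℝ))⁻¹) ^ (K - n)) D : (PBond (F.P K) 0 → Matrix (Fin N) (Fin N) ℂ) → BondIdx D → Matrix (Fin N) (Fin N) ℂ) 0) A) A))
                - B (fderiv ℂ (chartLogFlat (((((F.P K).L : ℝ))⁻¹) ^ (K - n)) D :
                    (PBond (F.P K) 0 → Matrix (Fin N) (Fin N) ℂ) → BondIdx D → Matrix (Fin N) (Fin N) ℂ) 0 A)
                    (((((((((F.P K).L : ℝ))⁻¹) ^ (K - n) : ℝ) : ℂ) ^ (F.P K).d) • MV) ((fun A : PBond (F.P K) 0 → Matrix (Fin N) (Fin N) ℂ => chartLogFlat (((((F.P K).L : ℝ))⁻¹) ^ (K - n)) D A -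
              (fderiv ℂ (chartLogFlat (((((F.P K).L : ℝ))⁻¹) ^ (K - n)) D : (PBond (F.P K) 0 → Matrix (Fin N) (Fin N) ℂ) → BondIdx D → Matrix (Fin N) (Fin N) ℂ) 0) A) A))
                + V0 (LatticeFieldCalculus.shiftEquiv (P := F.P K) (j := 0)) (fun _ _ => (1 : (Matrix (Fin N) (Fin N) ℂ)ˣ)) ((((F.P K).L : ℝ)⁻¹) ^ (K - n)) (F.P K).d
                    (τ : Matrix (Fin N) (Fin N) ℂ →ₗ[ℂ] ℂ) (fun μ x => (A - H ((fun A : PBond (F.P K) 0 → Matrix (Fin N) (Fin N) ℂ => chartLogFlat (((((F.P K).L : ℝ))⁻¹) ^ (K - n)) D A -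
              (fderiv ℂ (chartLogFlat (((((F.P K).L : ℝ))⁻¹) ^ (K - n)) D : (PBond (F.P K) 0 → Matrix (Fin N) (Fin N) ℂ) → BondIdx D → Matrix (Fin N) (Fin N) ℂ) 0) A) A)) ⟨x, μ⟩))
              (BE (W A')) A') ∧
          DifferentiableOn ℂ W {Y : PBond (F.P K) 0 → Matrix (Fin N) (Fin N) ℂ | (∀ b, w 1 b * ‖Y b‖ < ε) ∧
            ∀ (b : PBond (F.P K) 0) (ν : Fin (F.P K).d), w 2 b * ((F.P K).L : ℝ) ^ (K - n) * ‖Y ⟨b.src.shift ν, b.dir⟩ - Y b‖ < ε} ∧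
          (∀ (Y : PBond (F.P K) 0 → Matrix (Fin N) (Fin N) ℂ) (r : ℝ), r < ε → (∀ b, w 1 b * ‖Y b‖ ≤ r) →
            (∀ (b : PBond (F.P K) 0) (ν : Fin (F.P K).d), w 2 b * ((F.P K).L : ℝ) ^ (K - n) * ‖Y ⟨b.src.shift ν, b.dir⟩ - Y b‖ ≤ r) →
            ∀ b, w 3 b * ‖W Y b‖ ≤
              (θ₀ * O₁ * (CD * ε + ((F.P K).L : ℝ)) + 2 * O₁ * CD
                + (1 + θ₀ * ε * h₀) * ((((F.P K).d - 1 : ℕ) : ℝ) * (((F.P K).L : ℝ) ^ 2) ^ 3 * Mρ * (200 + 2 * ((F.P K).L : ℝ) ^ 2)) * ℓ ^ 2)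
                * r ^ 2) := by
  classical
  obtain ⟨Mh₀, R₀, O₁, Bf, h₀, hO₁, hBf, hh₀, hmain⟩ := exists_sectF_W_atRecord_flatChart N F
  -- the k-uniform remainder constants (functions of `L` only)
  set Rs : ℝ := (60800 * ((((4 : ℕ) + 2) * F.L : ℕ) : ℝ) ^ 2 * (F.L : ℝ))⁻¹ with hRs
  have hL1 : (1 : ℝ) ≤ F.L := by exact_mod_cast F.hL.2.le
  have hℓ1 : (1 : ℝ) ≤ ((((4 : ℕ) + 2) * F.L : ℕ) : ℝ) := by
    exact_mod_cast Nat.one_le_iff_ne_zero.mpr (Nat.mul_ne_zero (by omega) (by have := F.hL.2; omega))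
  have hden : 0 < 60800 * ((((4 : ℕ) + 2) * F.L : ℕ) : ℝ) ^ 2 * (F.L : ℝ) := by positivity
  have hRs0 : 0 < Rs := inv_pos.mpr hden
  refine ⟨Mh₀, max R₀ (2 * F.L), O₁, Bf, h₀, Rs / 4, 64 * (F.L : ℝ) / Rs, hO₁, hBf, hh₀, by linarith, div_nonneg (by positivity) hRs0.le, ?_⟩
  intro n K hk1 hk' Mh R a' hMha hMh hR hsize D hDk hAdm _ _ w hw H hH τ ρ hρ hτ hτs hτ1 Mρ hMρ hρn BE hBE B hB hBsymm hc wa hwa MV hMV hMsym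
  have hR₀ : R₀ ≤ R := le_trans (le_max_left _ _) hR
  have hRL : 2 * (F.P K).L ≤ R := le_trans (le_max_right _ _) hR
  have hMh1 : 1 ≤ Mh := by rw [hMha]; exact Nat.one_le_pow _ _ (F.P K).L_pos
  have hM1 : 1 ≤ F.L * Mh := Nat.mul_pos (F.P K).L_pos (by omega)
  obtain ⟨hε, hCD, h55, hcd⟩ := flatChartRemainderSocket_T4 N F K (K - n) hRL hM1 D hDk hAdm hw
  exact hmain n K hk1 hk' hMha hMh hR₀ hsize D hDk hAdm hw H hH hε hCD _ h55 hcd τ ρ hρ hτ hτs hτ1 hMρ hρn BE hBE B hB hBsymm hc hwa MV hMV hMsym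

end Summit.QuantumFields.YangMills.Theorems.K0Stub1SectFWSlotAtRecordFlatChartClosed

end
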